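import Literature.LinearAlgebra.TensorNetworks.JunctionTree
import HarnessLib

/-!
# From an abstract tensor network to its list form: the value is preserved

Topic `Literature/LinearAlgebra/TensorNetworks`, sequel of `Basic.lean` (`TensorNetwork.value`
over finite types) and `JunctionTree.lean` (`JT.netValue` of a list network: variables and values
are natural numbers, factors a list of symbols with `FactorOps`). Numbering the variables by
`eV : Var ≃ Fin nv`, the values by `eD : Dom ≃ Fin d` and listing the factors, a network becomes a
list network; if the list entries, read through a semiring hom `ψ`, are the abstract entries up to
constants `c f` (the integer rescaling of the Markov–Shi machine: Hadamard tensors times `2`),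
then `ψ (netValue) = (∏ f, c f) · value`:

* `encodeAssign eV eD g` (an abstract assignment as a map `ℕ → ℕ`), `encodeAssign_apply`,
  `encodeAssign_injective`, `image_encodeAssign` (its image is `JT.assignments (range nv) d`);
* **`map_netValue_eq_mul_value`**.

## References

* I. L. Markov, Y. Shi, SIAM J. Comput. 38 (2008), §3 (eq. (1): the value of a network) and §4
  (Thm. 4.6: it is what the contraction computes).
-/

namespace Literature.LinearAlgebra.TensorNetworks

namespace JT

open Finset Literature.Combinatorics.SimpleGraph.ListTD

variable {Var Dom : Type*} {nv d : ℕ}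

/-- **An abstract assignment as a map `ℕ → ℕ`**: the code of the value of the variable with the
given number, `0` beyond the variables. [folklore] -/
def encodeAssign (eV : Var ≃ Fin nv) (eD : Dom ≃ Fin d) (g : Var → Dom) : ℕ → ℕ :=
  fun x => if h : x < nv then ((eD (g (eV.symm ⟨x, h⟩)) : Fin d) : ℕ) else 0

/-- Reading the code of a variable. [folklore] -/
@[simp] theorem encodeAssign_apply (eV : Var ≃ Fin nv) (eD : Dom ≃ Fin d) (g : Var → Dom) (v : Var) :
    encodeAssign eV eD g (eV v) = eD (g v) := by
  simp [encodeAssign, (eV v).isLt]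

/-- Encoded assignments are assignments of the variables `< nv` over `{0, …, d-1}`. [folklore] -/
theorem encodeAssign_mem (eV : Var ≃ Fin nv) (eD : Dom ≃ Fin d) (g : Var → Dom) :
    encodeAssign eV eD g ∈ assignments (Finset.range nv) d := by
  refine mem_assignments.2 ⟨fun x hx => ?_, fun x hx => ?_⟩
  · simp only [encodeAssign, dif_pos (Finset.mem_range.1 hx)]; exact Fin.isLt _
  · have : ¬ x < nv := by simpa using hx
    simp [encodeAssign, this]

/-- The encoding is injective. [folklore] -/
theorem encodeAssign_injective (eV : Var ≃ Fin nv) (eD : Dom ≃ Fin d) :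
    Function.Injective (encodeAssign eV eD) := fun g g' h => by
  funext v
  have := congrFun h (eV v)
  rw [encodeAssign_apply, encodeAssign_apply] at this
  exact eD.injective (Fin.ext this)

open scoped Classical in
/-- **Every assignment is an encoded one.** [folklore] -/
theorem image_encodeAssign [Fintype Var] [DecidableEq Var] [Fintype Dom] (eV : Var ≃ Fin nv) (eD : Dom ≃ Fin d) :
    (Finset.univ : Finset (Var → Dom)).image (encodeAssign eV eD) = assignments (Finset.range nv) d := by
  ext a
  rw [Finset.mem_image]
  constructor
  · rintro ⟨g, -, rfl⟩; exact encodeAssign_mem eV eD g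
  · intro ha
    obtain ⟨h1, h2⟩ := mem_assignments.1 ha
    refine ⟨fun v => eD.symm ⟨a (eV v), h1 _ (Finset.mem_range.2 (eV v).isLt)⟩, Finset.mem_univ _, ?_⟩
    funext x
    by_cases hx : x < nv
    · simp only [encodeAssign, dif_pos hx, Equiv.apply_symm_apply]
    · rw [h2 x (by simpa using hx)]
      simp [encodeAssign, hx]

/-- **The list form has the value of the network, up to the rescaling constants**: if the factor
list is a listing of the factors through `recOf`, and every list entry read through `ψ` is
`c f` times the abstract entry, then `ψ (netValue) = (∏ f, c f) · value`.
[cite: MarkovShi2008, §3 (eq. (1)) and §4 (Thm 4.6)] -/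
theorem map_netValue_eq_mul_value {R S : Type*} [CommSemiring R] [CommSemiring S] {Factor Φ : Type*}
    [Fintype Var] [DecidableEq Var] [Fintype Dom] [Fintype Factor] [DecidableEq Factor] (ψ : R →+* S) (N : TensorNetwork S Var Dom Factor) (O : FactorOps R Φ)
    (eV : Var ≃ Fin nv) (eD : Dom ≃ Fin d) (recOf : Factor → Φ) (factorList : List Factor)
    (hnd : factorList.Nodup) (hall : ∀ f, f ∈ factorList) (c : Factor → S)
    (hO : ∀ f g, ψ (O.feval (recOf f) (encodeAssign eV eD g)) = c f * N.entry f g) :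
    ψ (netValue O nv d (factorList.map recOf)) = (∏ f, c f) * N.value := by
  classical
  have huniv : factorList.toFinset = Finset.univ := Finset.eq_univ_iff_forall.2 fun f => List.mem_toFinset.2 (hall f)
  have hprod : ∀ (h : Factor → S), (factorList.map h).prod = ∏ f, h f := fun h => by
    rw [← huniv, List.prod_toFinset h hnd]
  rw [netValue, map_sum, ← image_encodeAssign eV eD, Finset.sum_image fun g _ g' _ h => encodeAssign_injective eV eD h,
    TensorNetwork.value, Finset.mul_sum]
  refine Finset.sum_congr rfl fun g _ => ?_
  rw [map_list_prod, List.map_map, List.map_map]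
  have : ((fun φ => ψ (O.feval φ (encodeAssign eV eD g))) ∘ recOf) = fun f => c f * N.entry f g := by
    funext f; exact hO f g
  rw [show (⇑ψ ∘ fun φ => O.feval φ (encodeAssign eV eD g)) ∘ recOf = fun f => c f * N.entry f g from this, hprod,
    Finset.prod_mul_distrib]

end JT

end Literature.LinearAlgebra.TensorNetworks
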